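import Summits.HodgeConjecture.HodgeConjecture.Cruxes.BlochSeedDiscOne.ShellThreePairLaw

/-!
line stmt-HodgeConjecture-18881 Cruxes/BlochSeedDiscOne/Lines/birth.lean 814a6a70c14e831a stub_rung_pad4_seedAt

# FatBalance — the FAT-PATTERN BALANCE LAWS of an (A1)-clean design and the NULL-LINE AFFINITY of the letter symbols
(strengthen g23; evidence for the S⁺ programme OFF the axis road; imports only the farm-built `ShellThreePairLaw`)

HONEST LABEL.  Nothing in this file proves HC, HC_AV, HC_CM, H2, №4, item 26512 or item 18881; letters ≠ sheaves ≠ SEED.  It is a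
finite letter calculus about two-level letter designs (`DepthBoundA4.Design`), typed as evidence for the door of record
`RuleDPlate.SPlus 14 sigmaH 0` (closed on the AXIS road by `AxisSPlus.sPlusB_axisRoom_budget`, open exactly for designs with an
off-axis support letter, `AxisSPlus.sPlus_iff_offAxis`).  No `sorry`, no new axiom, no `instance`, no `notation`, no `native_decide`,
no `allowUnsafeReducibility`.

## What is typed (every height `h`, clause 1 of (A1) only — `A1e` —, no ring, no Rule D, no budget)

§1 `qv h ℓ` (= `2|x||y|` on the alphabet, `ShellThreePairLaw.qv_eq`) vanishes exactly on the AXIS letters (and the hub) and is positive on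
   the off-axis ("fat") letters (`qv_axis`, `qv_pos_of_offAxis`, `qv_eq_zero_iff`); the TRIPLE FAT WEIGHT of a cell at a placement `σ` is
   `fat3 h σ c = q(c_{σ0})·q(c_{σ1})·q(c_{σ2})` (`≥ 0`, and `≠ 0` iff the cell is off-axis at the three slots `σ0, σ1, σ2`).
§2 `wsum_re ∕ wsum_im`: real and imaginary parts of the Gaussian weighted sums of `RingTwoMassLaw.CI` are the integer `linZ` sums.
§3 **THE FAT BALANCE LAW** (`fat_balance`): for every placement `σ`,
     `Σ_N m·fat3·x(c_{σ3}) = Σ_P m·fat3·x(c_{σ3})`   and   `Σ_N m·fat3·y(c_{σ3}) = Σ_P m·fat3·y(c_{σ3})`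
   — the real and imaginary parts of the decorated e-row `(Q,Q,Q,ē)` of `ShellThreePairLaw.decorated_row_law_perm`.  In the ray-class
   language of `RayClassMeasure` (strengthen g22) this says: the `q`-weighted ray-class measure of the cells FAT ON THE TRIPLE `{σ0,σ1,σ2}`,
   projected to the free slot `σ3`, has equal mass on opposite rays (`ν(0) = ν(2)`, `ν(1) = ν(3)`).  Only cells off-axis at all three
   slots `σ0, σ1, σ2` are seen: axis cells and hub-bearing cells are invisible (obstruction (2) of memo-32 §3 — a fat cell is smeared over
   16 ray classes — is met by CONDITIONING ON THE FAT PATTERN).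
§4 **THE HALF-PLANE LAW** (`fat_halfplane_x ∕ _y`): if no supported P-cell fat on the triple points into the open half-plane `x > 0`
   at slot `σ3` and no supported N-cell fat on the triple points into `x < 0`, then NO supported N-cell fat on the triple points into
   `x > 0` either (and the same with `y`, and — applying the law to the reflected half-planes — with the roles of the signs exchanged).
   Read contrapositively: a triple-fat N-cell whose fourth letter points into an open half-plane forces a triple-fat cell of the design
   answering it — a P-cell pointing into the same open half-plane or an N-cell pointing into the opposite one.  Fat N-cells never stand alone.
§5 **NULL-LINE AFFINITY** (`selfInt_midpoint`): along three consecutive letters of a null line (`ℓ₀, ℓ₁, ℓ₂` with `ℓ₀ + ℓ₂ = 2ℓ₁`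
   coordinatewise and `ℓ₀ → ℓ₁` null) the self-intersection `p = a² − x² − y²` is affine: `p(ℓ₀) + p(ℓ₂) = 2·p(ℓ₁)`; `a`, `β`, `β̄`, `1`
   are affine trivially.  Hence EVERY symbol of the tensor calculus is affine along EVERY null line — the structural reason why zero-sum
   box patterns (`AxisRuleDInhabitant.lean`, R⋆: all fifteen multilinear moments vanish) kill the mixed rows on ANY frame of four null
   lines, bent or straight, and why the off-axis twin of R⋆ fails only at the HUB CORNER (the chain `H, (h−1;1,0), (h−2;1,1), …` is not
   one null line: `H → (h−2;1,1)` is not a null step), not in the tensor calculus.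

§6 **THE LONE FAT TOP LAW** (`lone_fat_top`; the typed core of the cascade): in an `A1e` design on the alphabet there is NO four-fat
   N-cell `y ∉ supp P` such that every other supported cell off-axis on `≥ 2` slots is a non-N P-cell DOMINATED by `y` (slotwise in the
   closed quadrant of `y_f` with `|x|, |y|` at least as large — where all in-quadrant Rule-D descendants of `y` live,
   `RayClassMeasure.lam_mono_of_nullStep`).  Proof = rows `(Q,Q,Q,ē)` and `(Q,Q,C,ē)` + the strict monotonicity of `κ/q = 1/|x| + 1/|y|`
   down a quadrant (`dom_ineq`, `dom_eq`): the signed combination `q(y_j)·(Q,Q,C,ē) − κ(y_j)·(Q,Q,Q,ē)` vanishes on `y`, is `≤ 0` on every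
   dominated cell and `= 0` only when the cell agrees with `y` at slot `j` (`slot_eq_of_lone`); four placements pin all four slots.  So the
   (A1) balance of a fat N-cell can never come from its own Rule-D shadow: it needs LATERAL fat cells — other two-fat N-cells, or two-fat
   P-cells not dominated by it.  (A1e only: no Rule D, no `Disj`, no Hall, no budget, every height.)

## Evidence recorded with this file (stdlib engine `eng/qsys.py`, `eng/e5b.py`, exact rational LP; memo STRENGTHEN-g23-memo-33 §4)
The full q-row system — all decorated rows over `{ē, e, C, Q}` with at least one `Q` and one `e/ē` (160 words up to conjugation; each an
instance of `decorated_row_law`) — restricted to a candidate family of hub-free cells is a homogeneous linear system in the masses, so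
its feasibility with `m ≥ 1` is scale-free and decided exactly over `ℚ`:
* the hub-free part of D◇ (14 N + 16 P four-fat boxes at level 12, strengthen g22) is feasible (104 rows, rank 29) — sanity;
* ONE four-fat N-cell `y = ((12;1,1),(12;−1,1),(12;−1,−1),(12;1,−1))` with its 8 one-slot and 6 two-slot Rule-D suppliers as the only
  other fat cells: INFEASIBLE (160 rows, rank 15 = number of cells);
* `y` with ALL 80 hub-free cells strictly below it inside co-level `≤ 3` as P-cells: INFEASIBLE (rank 64);
* `y` with the same 80 cells allowed on EITHER side: feasible (a 52-cell support, `y` the heaviest cell by a factor `≥ 7/2`).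
So P-cells below a top fat N-cell never balance it: further fat N-cells are forced (the typed shadow of this is §4), and the balancing
masses cascade — the mechanism behind the size of every known Rule-D inhabitant (R⋆: 9 908 copies; the diagonal-letter design of
anomaly g14: 13 106 copies).  The MASS LAW that would turn the cascade into `Σ_N m ≥ 59` off the axis is NOT typed here (open).
-/

set_option linter.dupNamespace false
set_option autoImplicit false

namespace Summit.HodgeConjecture.HodgeConjecture.Cruxes.BlochSeedDiscOne.FatBalance

open Summit.HodgeConjecture.HodgeConjecture.Cruxes.BlochSeedDiscOne.DepthBoundA4
open Summit.HodgeConjecture.HodgeConjecture.Cruxes.BlochSeedDiscOne.LeggedFloor (NullStep)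
open Summit.HodgeConjecture.HodgeConjecture.Cruxes.BlochSeedDiscOne.RingTwoMassLaw.CI (A1e a1e_of_a1 wsum wsum_cons wsum_nil)
open Summit.HodgeConjecture.HodgeConjecture.Cruxes.BlochSeedDiscOne.ShellThreePairLaw

/-! ## §1 The pair weight `q` on letters: zero on the axis, positive off it -/

theorem qv_axis {h : ℤ} {ℓ : Letter} (hℓ : ℓ.OnAlphabet h) (hax : ℓ.x = 0 ∨ ℓ.y = 0) : qv h ℓ = 0 := by
  rw [qv_eq hℓ]
  rcases hax with h0 | h0 <;> simp [h0]

theorem qv_pos_of_offAxis {h : ℤ} {ℓ : Letter} (hℓ : ℓ.OnAlphabet h) (hoff : OffAxis ℓ) : 0 < qv h ℓ := by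
  rw [qv_eq hℓ]
  have hx : 0 < |ℓ.x| := abs_pos.mpr hoff.1
  have hy : 0 < |ℓ.y| := abs_pos.mpr hoff.2
  positivity

theorem qv_eq_zero_iff {h : ℤ} {ℓ : Letter} (hℓ : ℓ.OnAlphabet h) : qv h ℓ = 0 ↔ ¬ OffAxis ℓ := by
  constructor
  · intro h0 hoff
    exact absurd h0 (ne_of_gt (qv_pos_of_offAxis hℓ hoff))
  · intro hn
    unfold OffAxis at hn
    push Not at hn
    by_cases hx : ℓ.x = 0
    · exact qv_axis hℓ (Or.inl hx)
    · exact qv_axis hℓ (Or.inr (hn hx))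

/-- the hub letter `(h; 0, 0)` has `q = 0`. -/
theorem qv_hub (h : ℤ) : qv h ⟨h, 0, 0⟩ = 0 := by
  unfold qv Letter.selfInt Letter.bnorm
  ring

/-- the TRIPLE FAT WEIGHT of a cell at the placement `σ`: `q(c_{σ0})·q(c_{σ1})·q(c_{σ2})`. -/
def fat3 (h : ℤ) (σ : Equiv.Perm (Fin 4)) (c : Cell) : ℤ := qv h (c (σ 0)) * qv h (c (σ 1)) * qv h (c (σ 2))

theorem fat3_nonneg {h : ℤ} {c : Cell} (hc : ∀ f : Fin 4, (c f).OnAlphabet h) (σ : Equiv.Perm (Fin 4)) : 0 ≤ fat3 h σ c := by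
  unfold fat3
  have h0 := qv_nonneg (hc (σ 0))
  have h1 := qv_nonneg (hc (σ 1))
  have h2 := qv_nonneg (hc (σ 2))
  positivity

/-- `fat3 ≠ 0` iff the cell is off-axis at the three slots `σ0, σ1, σ2`. -/
theorem fat3_ne_zero_iff {h : ℤ} {c : Cell} (hc : ∀ f : Fin 4, (c f).OnAlphabet h) (σ : Equiv.Perm (Fin 4)) :
    fat3 h σ c ≠ 0 ↔ OffAxis (c (σ 0)) ∧ OffAxis (c (σ 1)) ∧ OffAxis (c (σ 2)) := by
  unfold fat3
  rw [mul_ne_zero_iff, mul_ne_zero_iff]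
  have e0 : qv h (c (σ 0)) ≠ 0 ↔ OffAxis (c (σ 0)) := by rw [Ne, qv_eq_zero_iff (hc (σ 0)), not_not]
  have e1 : qv h (c (σ 1)) ≠ 0 ↔ OffAxis (c (σ 1)) := by rw [Ne, qv_eq_zero_iff (hc (σ 1)), not_not]
  have e2 : qv h (c (σ 2)) ≠ 0 ↔ OffAxis (c (σ 2)) := by rw [Ne, qv_eq_zero_iff (hc (σ 2)), not_not]
  rw [e0, e1, e2, and_assoc]

/-! ## §2 Real and imaginary parts of the Gaussian weighted sums -/

theorem wsum_re (L : List (Cell × ℕ)) (φ : Cell → GaussianInt) : (wsum L φ).re = linZ L (fun c => (φ c).re) := by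
  induction L with
  | nil => simp [wsum_nil, linZ_nil]
  | cons a t ih =>
    rw [wsum_cons, linZ_cons, ← ih]
    simp [Zsqrtd.re_mul]

theorem wsum_im (L : List (Cell × ℕ)) (φ : Cell → GaussianInt) : (wsum L φ).im = linZ L (fun c => (φ c).im) := by
  induction L with
  | nil => simp [wsum_nil, linZ_nil]
  | cons a t ih =>
    rw [wsum_cons, linZ_cons, ← ih]
    simp [Zsqrtd.im_mul]

theorem re_fat (q0 q1 q2 : ℤ) (ℓ : Letter) :
    (((q0 : ℤ) : GaussianInt) * ((q1 : ℤ) : GaussianInt) * ((q2 : ℤ) : GaussianInt) * ℓ.beta).re = q0 * q1 * q2 * ℓ.x := by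
  simp [Zsqrtd.re_mul, Zsqrtd.im_mul, Letter.beta]

theorem im_fat (q0 q1 q2 : ℤ) (ℓ : Letter) :
    (((q0 : ℤ) : GaussianInt) * ((q1 : ℤ) : GaussianInt) * ((q2 : ℤ) : GaussianInt) * ℓ.beta).im = q0 * q1 * q2 * ℓ.y := by
  simp [Zsqrtd.re_mul, Zsqrtd.im_mul, Letter.beta]

/-! ## §3 THE FAT BALANCE LAW -/

/-- the decorated row `(Q,Q,Q,ē)` placed by `σ`, verbatim from `decorated_row_law_perm`. -/
theorem fat_row (h : ℤ) (D : Design) (hA : A1e D) (σ : Equiv.Perm (Fin 4)) :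
    wsum D.N (fun c => ((qv h (c (σ 0)) : ℤ) : GaussianInt) * ((qv h (c (σ 1)) : ℤ) : GaussianInt)
        * ((qv h (c (σ 2)) : ℤ) : GaussianInt) * (c (σ 3)).beta)
      = wsum D.P (fun c => ((qv h (c (σ 0)) : ℤ) : GaussianInt) * ((qv h (c (σ 1)) : ℤ) : GaussianInt)
        * ((qv h (c (σ 2)) : ℤ) : GaussianInt) * (c (σ 3)).beta) :=
  decorated_row_law_perm h D hA ![DS.Q, DS.Q, DS.Q, DS.Eb] σ ⟨3, Or.inr rfl⟩ ⟨0, by decide⟩ ⟨0, by decide⟩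

/-- **THE FAT BALANCE LAW.**  For every placement `σ`: `Σ_N m·fat3·x_{σ3} = Σ_P m·fat3·x_{σ3}` and `Σ_N m·fat3·y_{σ3} = Σ_P m·fat3·y_{σ3}`. -/
theorem fat_balance (h : ℤ) (D : Design) (hA : A1e D) (σ : Equiv.Perm (Fin 4)) :
    linZ D.N (fun c => fat3 h σ c * (c (σ 3)).x) = linZ D.P (fun c => fat3 h σ c * (c (σ 3)).x)
    ∧ linZ D.N (fun c => fat3 h σ c * (c (σ 3)).y) = linZ D.P (fun c => fat3 h σ c * (c (σ 3)).y) := by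
  have key := fat_row h D hA σ
  constructor
  · have hre := congrArg Zsqrtd.re key
    rw [wsum_re, wsum_re] at hre
    simp only [re_fat] at hre
    exact hre
  · have him := congrArg Zsqrtd.im key
    rw [wsum_im, wsum_im] at him
    simp only [im_fat] at him
    exact him

/-- the fat balance law for a design with the full (A1). -/
theorem fat_balance_of_A1 (h : ℤ) (D : Design) (h1 : D.A1) (σ : Equiv.Perm (Fin 4)) :
    linZ D.N (fun c => fat3 h σ c * (c (σ 3)).x) = linZ D.P (fun c => fat3 h σ c * (c (σ 3)).x)
    ∧ linZ D.N (fun c => fat3 h σ c * (c (σ 3)).y) = linZ D.P (fun c => fat3 h σ c * (c (σ 3)).y) :=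
  fat_balance h D (a1e_of_a1 D h1) σ

/-! ## §4 THE HALF-PLANE LAW -/

/-- a `linZ` sum of termwise-nonnegative values that vanishes has every supported term zero. -/
theorem linZ_term_eq_zero (L : List (Cell × ℕ)) (φ : Cell → ℤ) (hnn : ∀ cm ∈ L, 0 < cm.2 → 0 ≤ φ cm.1)
    (h0 : linZ L φ = 0) : ∀ cm ∈ L, 0 < cm.2 → φ cm.1 = 0 := by
  induction L with
  | nil => intro cm hcm; simp at hcm
  | cons a t ih =>
    have ht : 0 ≤ linZ t φ := linZ_nonneg t φ fun cm hcm => hnn cm (List.mem_cons_of_mem _ hcm)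
    rw [linZ_cons] at h0
    have ha : 0 ≤ (a.2 : ℤ) * φ a.1 := by
      rcases Nat.eq_zero_or_pos a.2 with hz | hpos
      · rw [hz, Nat.cast_zero, zero_mul]
      · exact mul_nonneg (by exact_mod_cast Nat.zero_le _) (hnn a List.mem_cons_self hpos)
    have hta : linZ t φ = 0 := by linarith
    have haa : (a.2 : ℤ) * φ a.1 = 0 := by linarith
    intro cm hcm hpos
    rcases List.mem_cons.mp hcm with rfl | hmem
    · have hm : (cm.2 : ℤ) ≠ 0 := by exact_mod_cast Nat.pos_iff_ne_zero.mp hpos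
      exact (mul_eq_zero.mp haa).resolve_left hm
    · exact ih (fun cm' hcm' => hnn cm' (List.mem_cons_of_mem _ hcm')) hta cm hmem hpos

/-- `linZ` of a negated functional. -/
theorem linZ_neg (L : List (Cell × ℕ)) (φ : Cell → ℤ) : linZ L (fun c => -φ c) = -linZ L φ := by
  induction L with
  | nil => simp [linZ_nil]
  | cons a t ih => rw [linZ_cons, linZ_cons, ih]; ring

/-- **THE HALF-PLANE LAW (x).**  If every supported N-cell fat on the triple `σ0,σ1,σ2` has `x_{σ3} ≥ 0` and every supported P-cell fat on
the triple has `x_{σ3} ≤ 0`, then every supported N-cell fat on the triple has `x_{σ3} = 0` (and so does every supported P-cell). -/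
theorem fat_halfplane_x {h : ℤ} {D : Design} (hD : D.OnAlphabet h) (hA : A1e D) (σ : Equiv.Perm (Fin 4))
    (hN : ∀ c ∈ D.suppN, fat3 h σ c ≠ 0 → 0 ≤ (c (σ 3)).x) (hP : ∀ c ∈ D.suppP, fat3 h σ c ≠ 0 → (c (σ 3)).x ≤ 0) :
    (∀ c ∈ D.suppN, fat3 h σ c ≠ 0 → (c (σ 3)).x = 0) ∧ (∀ c ∈ D.suppP, fat3 h σ c ≠ 0 → (c (σ 3)).x = 0) := by
  have hbal := (fat_balance h D hA σ).1
  -- termwise signs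
  have hNt : ∀ cm ∈ D.N, 0 < cm.2 → 0 ≤ fat3 h σ cm.1 * (cm.1 (σ 3)).x := by
    intro cm hcm hpos
    have hA' := onAlphabet_of_N hD hcm hpos
    by_cases hf : fat3 h σ cm.1 = 0
    · rw [hf, zero_mul]
    · exact mul_nonneg (fat3_nonneg hA' σ) (hN cm.1 ((mem_suppN_iff D cm.1).mpr ⟨cm.2, hcm, hpos⟩) hf)
  have hPt : ∀ cm ∈ D.P, 0 < cm.2 → 0 ≤ -(fat3 h σ cm.1 * (cm.1 (σ 3)).x) := by
    intro cm hcm hpos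
    have hA' := onAlphabet_of_P hD hcm hpos
    by_cases hf : fat3 h σ cm.1 = 0
    · rw [hf, zero_mul, neg_zero]
    · have := hP cm.1 ((mem_suppP_iff D cm.1).mpr ⟨cm.2, hcm, hpos⟩) hf
      have hfn := fat3_nonneg hA' σ
      nlinarith
  have hSN : 0 ≤ linZ D.N (fun c => fat3 h σ c * (c (σ 3)).x) := linZ_nonneg _ _ hNt
  have hSP : 0 ≤ linZ D.P (fun c => -(fat3 h σ c * (c (σ 3)).x)) := linZ_nonneg _ _ hPt
  have hneg : linZ D.P (fun c => -(fat3 h σ c * (c (σ 3)).x)) = -linZ D.P (fun c => fat3 h σ c * (c (σ 3)).x) :=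
    linZ_neg D.P _
  have hN0 : linZ D.N (fun c => fat3 h σ c * (c (σ 3)).x) = 0 := by linarith
  have hP0 : linZ D.P (fun c => -(fat3 h σ c * (c (σ 3)).x)) = 0 := by linarith
  constructor
  · intro c hc hf
    obtain ⟨m, hm, hpos⟩ := (mem_suppN_iff D c).mp hc
    have := linZ_term_eq_zero D.N _ hNt hN0 (c, m) hm hpos
    exact (mul_eq_zero.mp this).resolve_left hf
  · intro c hc hf
    obtain ⟨m, hm, hpos⟩ := (mem_suppP_iff D c).mp hc
    have := linZ_term_eq_zero D.P _ hPt hP0 (c, m) hm hpos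
    have h2 : fat3 h σ c * (c (σ 3)).x = 0 := by simpa using this
    exact (mul_eq_zero.mp h2).resolve_left hf

/-- **THE HALF-PLANE LAW (y).** -/
theorem fat_halfplane_y {h : ℤ} {D : Design} (hD : D.OnAlphabet h) (hA : A1e D) (σ : Equiv.Perm (Fin 4))
    (hN : ∀ c ∈ D.suppN, fat3 h σ c ≠ 0 → 0 ≤ (c (σ 3)).y) (hP : ∀ c ∈ D.suppP, fat3 h σ c ≠ 0 → (c (σ 3)).y ≤ 0) :
    (∀ c ∈ D.suppN, fat3 h σ c ≠ 0 → (c (σ 3)).y = 0) ∧ (∀ c ∈ D.suppP, fat3 h σ c ≠ 0 → (c (σ 3)).y = 0) := by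
  have hbal := (fat_balance h D hA σ).2
  have hNt : ∀ cm ∈ D.N, 0 < cm.2 → 0 ≤ fat3 h σ cm.1 * (cm.1 (σ 3)).y := by
    intro cm hcm hpos
    have hA' := onAlphabet_of_N hD hcm hpos
    by_cases hf : fat3 h σ cm.1 = 0
    · rw [hf, zero_mul]
    · exact mul_nonneg (fat3_nonneg hA' σ) (hN cm.1 ((mem_suppN_iff D cm.1).mpr ⟨cm.2, hcm, hpos⟩) hf)
  have hPt : ∀ cm ∈ D.P, 0 < cm.2 → 0 ≤ -(fat3 h σ cm.1 * (cm.1 (σ 3)).y) := by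
    intro cm hcm hpos
    have hA' := onAlphabet_of_P hD hcm hpos
    by_cases hf : fat3 h σ cm.1 = 0
    · rw [hf, zero_mul, neg_zero]
    · have := hP cm.1 ((mem_suppP_iff D cm.1).mpr ⟨cm.2, hcm, hpos⟩) hf
      have hfn := fat3_nonneg hA' σ
      nlinarith
  have hSN : 0 ≤ linZ D.N (fun c => fat3 h σ c * (c (σ 3)).y) := linZ_nonneg _ _ hNt
  have hSP : 0 ≤ linZ D.P (fun c => -(fat3 h σ c * (c (σ 3)).y)) := linZ_nonneg _ _ hPt
  have hneg : linZ D.P (fun c => -(fat3 h σ c * (c (σ 3)).y)) = -linZ D.P (fun c => fat3 h σ c * (c (σ 3)).y) :=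
    linZ_neg D.P _
  have hN0 : linZ D.N (fun c => fat3 h σ c * (c (σ 3)).y) = 0 := by linarith
  have hP0 : linZ D.P (fun c => -(fat3 h σ c * (c (σ 3)).y)) = 0 := by linarith
  constructor
  · intro c hc hf
    obtain ⟨m, hm, hpos⟩ := (mem_suppN_iff D c).mp hc
    have := linZ_term_eq_zero D.N _ hNt hN0 (c, m) hm hpos
    exact (mul_eq_zero.mp this).resolve_left hf
  · intro c hc hf
    obtain ⟨m, hm, hpos⟩ := (mem_suppP_iff D c).mp hc
    have := linZ_term_eq_zero D.P _ hPt hP0 (c, m) hm hpos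
    have h2 : fat3 h σ c * (c (σ 3)).y = 0 := by simpa using this
    exact (mul_eq_zero.mp h2).resolve_left hf

/-- **FAT N-CELLS NEVER STAND ALONE** (contrapositive reading of the half-plane law, x-direction): a supported N-cell fat on the triple
with `x_{σ3} > 0` forces a supported cell fat on the triple ANSWERING it — a P-cell with `x_{σ3} > 0` or an N-cell with `x_{σ3} < 0`. -/
theorem fat_answer_x {h : ℤ} {D : Design} (hD : D.OnAlphabet h) (hA : A1e D) (σ : Equiv.Perm (Fin 4))
    {y : Cell} (hy : y ∈ D.suppN) (hfat : fat3 h σ y ≠ 0) (hx : 0 < (y (σ 3)).x) :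
    (∃ x ∈ D.suppP, fat3 h σ x ≠ 0 ∧ 0 < (x (σ 3)).x) ∨ (∃ y' ∈ D.suppN, fat3 h σ y' ≠ 0 ∧ (y' (σ 3)).x < 0) := by
  by_contra hcon
  push Not at hcon
  have hN : ∀ c ∈ D.suppN, fat3 h σ c ≠ 0 → 0 ≤ (c (σ 3)).x := fun c hc hf => hcon.2 c hc hf
  have hP : ∀ c ∈ D.suppP, fat3 h σ c ≠ 0 → (c (σ 3)).x ≤ 0 := fun c hc hf => hcon.1 c hc hf
  have := (fat_halfplane_x hD hA σ hN hP).1 y hy hfat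
  omega

/-- the same in the y-direction. -/
theorem fat_answer_y {h : ℤ} {D : Design} (hD : D.OnAlphabet h) (hA : A1e D) (σ : Equiv.Perm (Fin 4))
    {y : Cell} (hy : y ∈ D.suppN) (hfat : fat3 h σ y ≠ 0) (hx : 0 < (y (σ 3)).y) :
    (∃ x ∈ D.suppP, fat3 h σ x ≠ 0 ∧ 0 < (x (σ 3)).y) ∨ (∃ y' ∈ D.suppN, fat3 h σ y' ≠ 0 ∧ (y' (σ 3)).y < 0) := by
  by_contra hcon
  push Not at hcon
  have hN : ∀ c ∈ D.suppN, fat3 h σ c ≠ 0 → 0 ≤ (c (σ 3)).y := fun c hc hf => hcon.2 c hc hf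
  have hP : ∀ c ∈ D.suppP, fat3 h σ c ≠ 0 → (c (σ 3)).y ≤ 0 := fun c hc hf => hcon.1 c hc hf
  have := (fat_halfplane_y hD hA σ hN hP).1 y hy hfat
  omega

/-! ## §5 NULL-LINE AFFINITY of the letter symbols -/

/-- **NULL-LINE AFFINITY.**  For three consecutive letters of a null line — `ℓ₀ + ℓ₂ = 2ℓ₁` coordinatewise, `ℓ₀ → ℓ₁` null —
the self-intersection `p = a² − (x² + y²)` is affine: `p(ℓ₀) + p(ℓ₂) = 2 p(ℓ₁)`. -/
theorem selfInt_midpoint (ℓ₀ ℓ₁ ℓ₂ : Letter) (ha : ℓ₀.a + ℓ₂.a = 2 * ℓ₁.a) (hx : ℓ₀.x + ℓ₂.x = 2 * ℓ₁.x)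
    (hy : ℓ₀.y + ℓ₂.y = 2 * ℓ₁.y) (hnull : (ℓ₁.x - ℓ₀.x) ^ 2 + (ℓ₁.y - ℓ₀.y) ^ 2 = (ℓ₁.a - ℓ₀.a) ^ 2) :
    ℓ₀.selfInt + ℓ₂.selfInt = 2 * ℓ₁.selfInt := by
  unfold Letter.selfInt Letter.bnorm
  have h2a : ℓ₂.a = 2 * ℓ₁.a - ℓ₀.a := by omega
  have h2x : ℓ₂.x = 2 * ℓ₁.x - ℓ₀.x := by omega
  have h2y : ℓ₂.y = 2 * ℓ₁.y - ℓ₀.y := by omega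
  rw [h2a, h2x, h2y]
  nlinarith [hnull]

/-- the same for a genuine NULL STEP `ℓ₀ → ℓ₁` of `LeggedFloor` continued one more step to `ℓ₂`. -/
theorem selfInt_midpoint_of_nullStep (ℓ₀ ℓ₁ ℓ₂ : Letter) (hs : NullStep ℓ₀ ℓ₁) (ha : ℓ₀.a + ℓ₂.a = 2 * ℓ₁.a)
    (hx : ℓ₀.x + ℓ₂.x = 2 * ℓ₁.x) (hy : ℓ₀.y + ℓ₂.y = 2 * ℓ₁.y) :
    ℓ₀.selfInt + ℓ₂.selfInt = 2 * ℓ₁.selfInt :=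
  selfInt_midpoint ℓ₀ ℓ₁ ℓ₂ ha hx hy hs.2

/-- digits: the bent chain `H = (14;0,0), (13;1,0), (12;1,1)` at `h = 14` is NOT affine in `p` (`196 + 142 ≠ 2·168`), while the straight
null line `(13;1,0), (12;1,1), (11;1,2)` is (`168 + 116 = 2·142`) — the hub corner of the off-axis twin of R⋆. -/
theorem hub_corner_digits :
    Letter.selfInt ⟨14, 0, 0⟩ + Letter.selfInt ⟨12, 1, 1⟩ ≠ 2 * Letter.selfInt ⟨13, 1, 0⟩
    ∧ Letter.selfInt ⟨13, 1, 0⟩ + Letter.selfInt ⟨11, 1, 2⟩ = 2 * Letter.selfInt ⟨12, 1, 1⟩ := by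
  unfold Letter.selfInt Letter.bnorm
  norm_num

/-! ## §6 THE LONE FAT TOP LAW — a fat N-cell is never balanced by its own shadow

The rows `(Q,Q,Q,ē)` (§3) and `(Q,Q,C,ē)` together with the STRICT MONOTONICITY of `κ/q = 1/|x| + 1/|y|` down a quadrant prove:
in an `A1e` design on the alphabet there is no four-fat N-cell `y ∉ supp P` such that every OTHER supported cell off-axis on at least two
slots is a P-cell, not an N-cell, DOMINATED by `y` (slotwise in the closed quadrant of `y` with coordinates at least as large in absolute
value — by `RayClassMeasure.lam_mono_of_nullStep` this is where all in-quadrant Rule-D descendants of `y` live).  Exact-LP digit behind it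
(E5c/E5d): `y = (d₀,d₁,d₂,d₃)` with all 1 295 cells below it inside co-level `≤ 4` as P-columns is infeasible, and the infeasibility is
carried by the two word types `(Q,Q,Q,ē)`, `(Q,Q,C,ē)` alone (16 of 77 symmetrised rows). -/

/-- `y` DOMINATES `c`: at every slot `c_f` lies in the closed quadrant of `y_f` with `|x|, |y|` at least as large. -/
def Dominates (y c : Cell) : Prop :=
  ∀ f : Fin 4, |(y f).x| ≤ |(c f).x| ∧ |(y f).y| ≤ |(c f).y| ∧ 0 ≤ (y f).x * (c f).x ∧ 0 ≤ (y f).y * (c f).y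

/-- off-axis on at least two slots. -/
def TwoFat (c : Cell) : Prop := ∃ f g : Fin 4, f ≠ g ∧ OffAxis (c f) ∧ OffAxis (c g)

/-- the MIXED FAT WEIGHT at a placement: `q(c_{σ0})·q(c_{σ1})·(h − a(c_{σ2}))`. -/
def fat2C (h : ℤ) (σ : Equiv.Perm (Fin 4)) (c : Cell) : ℤ := qv h (c (σ 0)) * qv h (c (σ 1)) * (h - (c (σ 2)).a)

/-- the decorated row `(Q,Q,C,ē)` placed by `σ`. -/
theorem mixed_fat_row (h : ℤ) (D : Design) (hA : A1e D) (σ : Equiv.Perm (Fin 4)) :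
    wsum D.N (fun c => ((qv h (c (σ 0)) : ℤ) : GaussianInt) * ((qv h (c (σ 1)) : ℤ) : GaussianInt)
        * (((h - (c (σ 2)).a : ℤ)) : GaussianInt) * (c (σ 3)).beta)
      = wsum D.P (fun c => ((qv h (c (σ 0)) : ℤ) : GaussianInt) * ((qv h (c (σ 1)) : ℤ) : GaussianInt)
        * (((h - (c (σ 2)).a : ℤ)) : GaussianInt) * (c (σ 3)).beta) :=
  decorated_row_law_perm h D hA ![DS.Q, DS.Q, DS.C, DS.Eb] σ ⟨3, Or.inr rfl⟩ ⟨0, by decide⟩ ⟨0, by decide⟩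

/-- **THE MIXED FAT BALANCE LAW** (x-part): `Σ_N m·fat2C·x_{σ3} = Σ_P m·fat2C·x_{σ3}`. -/
theorem mixed_fat_balance (h : ℤ) (D : Design) (hA : A1e D) (σ : Equiv.Perm (Fin 4)) :
    linZ D.N (fun c => fat2C h σ c * (c (σ 3)).x) = linZ D.P (fun c => fat2C h σ c * (c (σ 3)).x) := by
  have hre := congrArg Zsqrtd.re (mixed_fat_row h D hA σ)
  rw [wsum_re, wsum_re] at hre
  simp only [re_fat] at hre
  exact hre

/-- `linZ` of a functional times a constant. -/
theorem linZ_mul_const (L : List (Cell × ℕ)) (φ : Cell → ℤ) (a : ℤ) : linZ L (fun c => φ c * a) = linZ L φ * a := by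
  induction L with
  | nil => simp [linZ_nil]
  | cons b t ih => rw [linZ_cons, linZ_cons, ih]; ring

theorem linZ_sub' (L : List (Cell × ℕ)) (φ ψ : Cell → ℤ) : linZ L (fun c => φ c - ψ c) = linZ L φ - linZ L ψ := by
  induction L with
  | nil => simp [linZ_nil]
  | cons b t ih => rw [linZ_cons, linZ_cons, linZ_cons, ih]; ring

/-- the MONOTONICITY of `κ/q` down a quadrant, cleared of denominators: for `ℓ⁰` off-axis and `ℓ` with `|x⁰| ≤ |x|`, `|y⁰| ≤ |y|`,
`q(ℓ⁰)·κ(ℓ) ≤ κ(ℓ⁰)·q(ℓ)`. -/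
theorem dom_ineq {h : ℤ} {ℓ0 ℓ : Letter} (h0 : ℓ0.OnAlphabet h) (hℓ : ℓ.OnAlphabet h)
    (hx : |ℓ0.x| ≤ |ℓ.x|) (hy : |ℓ0.y| ≤ |ℓ.y|) :
    qv h ℓ0 * (h - ℓ.a) ≤ (h - ℓ0.a) * qv h ℓ := by
  rw [qv_eq h0, qv_eq hℓ, col_eq h0, col_eq hℓ]
  unfold Letter.colevel
  have ha := abs_nonneg ℓ0.x
  have hb := abs_nonneg ℓ0.y
  nlinarith [mul_nonneg ha hb, mul_nonneg (abs_nonneg ℓ.x) (abs_nonneg ℓ.y), mul_nonneg ha (sub_nonneg.mpr hy),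
    mul_nonneg hb (sub_nonneg.mpr hx), mul_nonneg (mul_nonneg ha (abs_nonneg ℓ.x)) (sub_nonneg.mpr hy),
    mul_nonneg (mul_nonneg hb (abs_nonneg ℓ.y)) (sub_nonneg.mpr hx)]

/-- … with equality only when the absolute coordinates agree. -/
theorem dom_eq {h : ℤ} {ℓ0 ℓ : Letter} (h0 : ℓ0.OnAlphabet h) (hℓ : ℓ.OnAlphabet h) (hoff : OffAxis ℓ0)
    (hx : |ℓ0.x| ≤ |ℓ.x|) (hy : |ℓ0.y| ≤ |ℓ.y|) (heq : qv h ℓ0 * (h - ℓ.a) = (h - ℓ0.a) * qv h ℓ) :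
    |ℓ.x| = |ℓ0.x| ∧ |ℓ.y| = |ℓ0.y| := by
  rw [qv_eq h0, qv_eq hℓ, col_eq h0, col_eq hℓ] at heq
  unfold Letter.colevel at heq
  have ha : 0 < |ℓ0.x| := abs_pos.mpr hoff.1
  have hb : 0 < |ℓ0.y| := abs_pos.mpr hoff.2
  have hX : 0 < |ℓ.x| := lt_of_lt_of_le ha hx
  have hY : 0 < |ℓ.y| := lt_of_lt_of_le hb hy
  -- heq ⟺ |x⁰||x|(|y| − |y⁰|) + |y⁰||y|(|x| − |x⁰|) = 0
  have key : |ℓ0.x| * |ℓ.x| * (|ℓ.y| - |ℓ0.y|) + |ℓ0.y| * |ℓ.y| * (|ℓ.x| - |ℓ0.x|) = 0 := by nlinarith [heq]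
  have t1 : 0 ≤ |ℓ0.x| * |ℓ.x| * (|ℓ.y| - |ℓ0.y|) := mul_nonneg (mul_nonneg ha.le hX.le) (sub_nonneg.mpr hy)
  have t2 : 0 ≤ |ℓ0.y| * |ℓ.y| * (|ℓ.x| - |ℓ0.x|) := mul_nonneg (mul_nonneg hb.le hY.le) (sub_nonneg.mpr hx)
  have z1 : |ℓ0.x| * |ℓ.x| * (|ℓ.y| - |ℓ0.y|) = 0 := by linarith
  have z2 : |ℓ0.y| * |ℓ.y| * (|ℓ.x| - |ℓ0.x|) = 0 := by linarith
  have p1 : |ℓ0.x| * |ℓ.x| ≠ 0 := by positivity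
  have p2 : |ℓ0.y| * |ℓ.y| ≠ 0 := by positivity
  have e1 := (mul_eq_zero.mp z1).resolve_left p1
  have e2 := (mul_eq_zero.mp z2).resolve_left p2
  constructor <;> linarith

/-- same closed half-line and same absolute value ⟹ same coordinate. -/
theorem eq_of_abs_eq_of_sign {a b : ℤ} (hab : |b| = |a|) (hs : 0 ≤ a * b) (ha : a ≠ 0) : b = a := by
  rcases abs_eq_abs.mp hab with h1 | h1
  · exact h1
  · exfalso
    rw [h1] at hs
    have : 0 < a * a := mul_self_pos.mpr ha
    linarith

/-- two letters of the alphabet with the same `(x, y)` are equal. -/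
theorem letter_eq_of_xy {h : ℤ} {ℓ ℓ' : Letter} (hℓ : ℓ.OnAlphabet h) (hℓ' : ℓ'.OnAlphabet h) (hx : ℓ.x = ℓ'.x)
    (hy : ℓ.y = ℓ'.y) : ℓ = ℓ' := by
  have h1 := hℓ.1
  have h2 := hℓ'.1
  unfold Letter.height at h1 h2
  rw [hx, hy] at h1
  have ha : ℓ.a = ℓ'.a := by linarith
  cases ℓ
  cases ℓ'
  simp only at ha hx hy
  rw [ha, hx, hy]

/-- a dominated cell (by a four-fat cell) is four-fat. -/
theorem offAxis_of_dominates {y c : Cell} (hfat : ∀ f, OffAxis (y f)) (hdom : Dominates y c) (f : Fin 4) : OffAxis (c f) := by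
  obtain ⟨hx, hy, _, _⟩ := hdom f
  have h1 : 0 < |(y f).x| := abs_pos.mpr (hfat f).1
  have h2 : 0 < |(y f).y| := abs_pos.mpr (hfat f).2
  exact ⟨abs_pos.mp (lt_of_lt_of_le h1 hx), abs_pos.mp (lt_of_lt_of_le h2 hy)⟩

/-- a cell off-axis on at most one slot has `q(c_f)·q(c_g) = 0` for `f ≠ g`. -/
theorem qq_eq_zero_of_not_twoFat {h : ℤ} {c : Cell} (hc : ∀ f, (c f).OnAlphabet h) (hnt : ¬ TwoFat c) {f g : Fin 4}
    (hfg : f ≠ g) : qv h (c f) * qv h (c g) = 0 := by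
  by_contra hne
  obtain ⟨h1, h2⟩ := mul_ne_zero_iff.mp hne
  have o1 : OffAxis (c f) := by by_contra hn; exact h1 ((qv_eq_zero_iff (hc f)).mpr hn)
  have o2 : OffAxis (c g) := by by_contra hn; exact h2 ((qv_eq_zero_iff (hc g)).mpr hn)
  exact hnt ⟨f, g, hfg, o1, o2⟩

/-- THE SLOT STEP of the lone-fat-top law: under the lone-top hypotheses every supported two-fat P-cell agrees with `y` at slot `σ 2`. -/
theorem slot_eq_of_lone {h : ℤ} {D : Design} (hD : D.OnAlphabet h) (hA : A1e D) {y : Cell} (hy : y ∈ D.suppN)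
    (hyP : y ∉ D.suppP) (hfat : ∀ f, OffAxis (y f))
    (hlone : ∀ c, (c ∈ D.suppN ∨ c ∈ D.suppP) → c ≠ y → TwoFat c → c ∉ D.suppN ∧ Dominates y c)
    (σ : Equiv.Perm (Fin 4)) : ∀ x ∈ D.suppP, TwoFat x → x (σ 2) = y (σ 2) := by
  have hyA : ∀ f, (y f).OnAlphabet h := hD y (List.mem_append.mpr (Or.inl hy))
  -- constants of y
  set q0 : ℤ := qv h (y (σ 2)) with hq0
  set k0 : ℤ := h - (y (σ 2)).a with hk0
  set s : ℤ := (y (σ 3)).x with hs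
  -- the signed combination W(c) = (q0·fat2C(c) − k0·fat3(c))·x(c_{σ3})·s
  let W : Cell → ℤ := fun c => (q0 * (fat2C h σ c * (c (σ 3)).x) - k0 * (fat3 h σ c * (c (σ 3)).x)) * s
  have hAx := (fat_balance h D hA σ).1
  have hBx := mixed_fat_balance h D hA σ
  -- the identity Σ_N m W = Σ_P m W
  have hW : ∀ L : List (Cell × ℕ), linZ L W
      = (q0 * linZ L (fun c => fat2C h σ c * (c (σ 3)).x) - k0 * linZ L (fun c => fat3 h σ c * (c (σ 3)).x)) * s := by
    intro L
    show linZ L (fun c => (q0 * (fat2C h σ c * (c (σ 3)).x) - k0 * (fat3 h σ c * (c (σ 3)).x)) * s) = _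
    rw [linZ_mul_const, linZ_sub']
    congr 2
    · have := linZ_mul_const L (fun c => fat2C h σ c * (c (σ 3)).x) q0
      rw [mul_comm] at this; rw [← this]; congr 1; funext c; ring
    · have := linZ_mul_const L (fun c => fat3 h σ c * (c (σ 3)).x) k0
      rw [mul_comm] at this; rw [← this]; congr 1; funext c; ring
  have hid : linZ D.N W = linZ D.P W := by rw [hW, hW, hAx, hBx]
  -- W as a product: W c = q(c0) q(c1) (q0 κ(c2) − k0 q(c2)) x(c3) s
  have hWc : ∀ c : Cell, W c = qv h (c (σ 0)) * qv h (c (σ 1)) * ((q0 * (h - (c (σ 2)).a) - k0 * qv h (c (σ 2))) * ((c (σ 3)).x * s)) := by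
    intro c; show (q0 * (fat2C h σ c * (c (σ 3)).x) - k0 * (fat3 h σ c * (c (σ 3)).x)) * s = _; unfold fat2C fat3; ring
  have hσ01 : σ 0 ≠ σ 1 := fun e => absurd (σ.injective e) (by decide)
  -- N-side: every supported term vanishes
  have hN0 : ∀ cm ∈ D.N, 0 < cm.2 → W cm.1 = 0 := by
    intro cm hcm hpos
    have hc : cm.1 ∈ D.suppN := (mem_suppN_iff D cm.1).mpr ⟨cm.2, hcm, hpos⟩
    have hcA := onAlphabet_of_N hD hcm hpos
    by_cases hcy : cm.1 = y
    · rw [hWc, hcy]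
      have : q0 * (h - (y (σ 2)).a) - k0 * qv h (y (σ 2)) = 0 := by rw [hq0, hk0]; ring
      rw [this]; ring
    · by_cases htf : TwoFat cm.1
      · exact absurd hc (hlone cm.1 (Or.inl hc) hcy htf).1
      · rw [hWc, qq_eq_zero_of_not_twoFat hcA htf hσ01]; ring
  -- P-side: every supported term is ≤ 0
  have hPle : ∀ cm ∈ D.P, 0 < cm.2 → 0 ≤ -W cm.1 := by
    intro cm hcm hpos
    have hc : cm.1 ∈ D.suppP := (mem_suppP_iff D cm.1).mpr ⟨cm.2, hcm, hpos⟩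
    have hcA := onAlphabet_of_P hD hcm hpos
    by_cases htf : TwoFat cm.1
    · have hcy : cm.1 ≠ y := fun e => hyP (e ▸ hc)
      obtain ⟨_, hdom⟩ := hlone cm.1 (Or.inr hc) hcy htf
      obtain ⟨hx2, hy2, _, _⟩ := hdom (σ 2)
      obtain ⟨_, _, hsx3, _⟩ := hdom (σ 3)
      have hineq := dom_ineq (hyA (σ 2)) (hcA (σ 2)) hx2 hy2
      have hmid : q0 * (h - (cm.1 (σ 2)).a) - k0 * qv h (cm.1 (σ 2)) ≤ 0 := by rw [hq0, hk0]; linarith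
      have hq01 : 0 ≤ qv h (cm.1 (σ 0)) * qv h (cm.1 (σ 1)) := mul_nonneg (qv_nonneg (hcA (σ 0))) (qv_nonneg (hcA (σ 1)))
      have hxs : 0 ≤ (cm.1 (σ 3)).x * s := by rw [hs, mul_comm]; exact hsx3
      rw [hWc]
      have := mul_nonneg hq01 (mul_nonneg (neg_nonneg.mpr hmid) hxs)
      nlinarith
    · rw [hWc, qq_eq_zero_of_not_twoFat hcA htf hσ01]; simp
  have hSN : linZ D.N W = 0 := linZ_eq_zero_of_vanish D.N W hN0
  have hSP : linZ D.P (fun c => -W c) = 0 := by rw [linZ_neg, ← hid, hSN, neg_zero]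
  -- hence every supported P term vanishes
  intro x hx htf
  obtain ⟨m, hm, hpos⟩ := (mem_suppP_iff D x).mp hx
  have hz : -W x = 0 := linZ_term_eq_zero D.P (fun c => -W c) hPle hSP (x, m) hm hpos
  have hxA : ∀ f, (x f).OnAlphabet h := hD x (List.mem_append.mpr (Or.inr hx))
  have hxy : x ≠ y := fun e => hyP (e ▸ hx)
  obtain ⟨_, hdom⟩ := hlone x (Or.inr hx) hxy htf
  have hxfat : ∀ f, OffAxis (x f) := offAxis_of_dominates hfat hdom
  obtain ⟨hx2, hy2, hsx2, hsy2⟩ := hdom (σ 2)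
  obtain ⟨hx3, _, hsx3, _⟩ := hdom (σ 3)
  have hq01 : 0 < qv h (x (σ 0)) * qv h (x (σ 1)) :=
    mul_pos (qv_pos_of_offAxis (hxA (σ 0)) (hxfat (σ 0))) (qv_pos_of_offAxis (hxA (σ 1)) (hxfat (σ 1)))
  have hxs : 0 < (x (σ 3)).x * s := by
    rw [hs]
    have h3 : (x (σ 3)).x ≠ 0 := (hxfat (σ 3)).1
    have hs0 : (y (σ 3)).x ≠ 0 := (hfat (σ 3)).1
    rcases lt_or_eq_of_le hsx3 with hlt | heq
    · rw [mul_comm]; exact hlt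
    · exfalso; exact (mul_ne_zero hs0 h3) heq.symm
  have hWx : W x = 0 := by linarith
  rw [hWc] at hWx
  have hmid0 : q0 * (h - (x (σ 2)).a) - k0 * qv h (x (σ 2)) = 0 := by
    rcases mul_eq_zero.mp hWx with h1 | h1
    · exact absurd h1 (ne_of_gt hq01)
    · rcases mul_eq_zero.mp h1 with h2 | h2
      · exact h2
      · exact absurd h2 (ne_of_gt hxs)
  have heq : qv h (y (σ 2)) * (h - (x (σ 2)).a) = (h - (y (σ 2)).a) * qv h (x (σ 2)) := by rw [hq0, hk0] at hmid0; linarith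
  obtain ⟨ex, ey⟩ := dom_eq (hyA (σ 2)) (hxA (σ 2)) (hfat (σ 2)) hx2 hy2 heq
  have e1 : (x (σ 2)).x = (y (σ 2)).x := eq_of_abs_eq_of_sign ex hsx2 (hfat (σ 2)).1
  have e2 : (x (σ 2)).y = (y (σ 2)).y := eq_of_abs_eq_of_sign ey hsy2 (hfat (σ 2)).2
  exact letter_eq_of_xy (hxA (σ 2)) (hyA (σ 2)) e1 e2

/-- the four placements used to pin all four slots. -/
def sig2 : Equiv.Perm (Fin 4) := Equiv.swap 2 3
def sig0 : Equiv.Perm (Fin 4) := Equiv.swap 0 2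
def sig1 : Equiv.Perm (Fin 4) := Equiv.swap 1 2

theorem sig_vals : (Equiv.refl (Fin 4)) 2 = 2 ∧ sig2 2 = 3 ∧ sig0 2 = 0 ∧ sig1 2 = 1 := by
  refine ⟨rfl, ?_, ?_, ?_⟩ <;> decide

/-- **THE LONE FAT TOP LAW.**  In an `A1e` design on the alphabet there is no four-fat N-cell `y ∉ supp P` such that every other supported
cell that is off-axis on at least two slots is a non-N P-cell dominated by `y`. -/
theorem lone_fat_top {h : ℤ} {D : Design} (hD : D.OnAlphabet h) (hA : A1e D) {y : Cell} (hy : y ∈ D.suppN) (hyP : y ∉ D.suppP)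
    (hfat : ∀ f, OffAxis (y f))
    (hlone : ∀ c, (c ∈ D.suppN ∨ c ∈ D.suppP) → c ≠ y → TwoFat c → c ∉ D.suppN ∧ Dominates y c) : False := by
  have hyA : ∀ f, (y f).OnAlphabet h := hD y (List.mem_append.mpr (Or.inl hy))
  -- step 1: no supported P-cell is two-fat (else it equals y at every slot)
  have hnoP : ∀ x ∈ D.suppP, ¬ TwoFat x := by
    intro x hx htf
    have e2 : x 2 = y 2 := slot_eq_of_lone hD hA hy hyP hfat hlone (Equiv.refl _) x hx htf
    have e3 : x 3 = y 3 := by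
      have := slot_eq_of_lone hD hA hy hyP hfat hlone sig2 x hx htf; rwa [sig_vals.2.1] at this
    have e0 : x 0 = y 0 := by
      have := slot_eq_of_lone hD hA hy hyP hfat hlone sig0 x hx htf; rwa [sig_vals.2.2.1] at this
    have e1 : x 1 = y 1 := by
      have := slot_eq_of_lone hD hA hy hyP hfat hlone sig1 x hx htf; rwa [sig_vals.2.2.2] at this
    have hxy : x = y := by
      funext f
      match f with
      | ⟨0, _⟩ => exact e0
      | ⟨1, _⟩ => exact e1
      | ⟨2, _⟩ => exact e2
      | ⟨3, _⟩ => exact e3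
    exact hyP (hxy ▸ hx)
  -- step 2: the `(Q,Q,Q,ē)` row at the identity placement then sees `y` alone
  have hAx := (fat_balance h D hA (Equiv.refl _)).1
  let V : Cell → ℤ := fun c => fat3 h (Equiv.refl _) c * (c 3).x * (y 3).x
  have hP0 : linZ D.P V = 0 := by
    apply linZ_eq_zero_of_vanish
    intro cm hcm hpos
    have hc : cm.1 ∈ D.suppP := (mem_suppP_iff D cm.1).mpr ⟨cm.2, hcm, hpos⟩
    have hcA := onAlphabet_of_P hD hcm hpos
    have : fat3 h (Equiv.refl _) cm.1 = 0 := by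
      by_contra hne
      obtain ⟨o0, o1, _⟩ := (fat3_ne_zero_iff hcA (Equiv.refl _)).mp hne
      exact hnoP cm.1 hc ⟨0, 1, by decide, o0, o1⟩
    show fat3 h (Equiv.refl _) cm.1 * (cm.1 3).x * (y 3).x = 0
    rw [this]; ring
  have hNnn : ∀ cm ∈ D.N, 0 < cm.2 → 0 ≤ V cm.1 := by
    intro cm hcm hpos
    have hc : cm.1 ∈ D.suppN := (mem_suppN_iff D cm.1).mpr ⟨cm.2, hcm, hpos⟩
    have hcA := onAlphabet_of_N hD hcm hpos
    by_cases hcy : cm.1 = y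
    · show 0 ≤ fat3 h (Equiv.refl _) cm.1 * (cm.1 3).x * (y 3).x
      rw [hcy]
      have := fat3_nonneg hyA (Equiv.refl _)
      have hsq : 0 ≤ (y 3).x * (y 3).x := mul_self_nonneg _
      nlinarith
    · have : fat3 h (Equiv.refl _) cm.1 = 0 := by
        by_contra hne
        obtain ⟨o0, o1, _⟩ := (fat3_ne_zero_iff hcA (Equiv.refl _)).mp hne
        exact (hlone cm.1 (Or.inl hc) hcy ⟨0, 1, by decide, o0, o1⟩).1 hc
      show 0 ≤ fat3 h (Equiv.refl _) cm.1 * (cm.1 3).x * (y 3).x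
      rw [this]; simp
  have hVN : linZ D.N V = linZ D.N (fun c => fat3 h (Equiv.refl _) c * (c 3).x) * (y 3).x := by
    show linZ D.N (fun c => fat3 h (Equiv.refl _) c * (c 3).x * (y 3).x) = _; rw [linZ_mul_const]
  have hVP : linZ D.P V = linZ D.P (fun c => fat3 h (Equiv.refl _) c * (c 3).x) * (y 3).x := by
    show linZ D.P (fun c => fat3 h (Equiv.refl _) c * (c 3).x * (y 3).x) = _; rw [linZ_mul_const]
  have hN0 : linZ D.N V = 0 := by
    rw [hVN]
    have : linZ D.N (fun c => fat3 h (Equiv.refl _) c * (c 3).x) = linZ D.P (fun c => fat3 h (Equiv.refl _) c * (c 3).x) := hAx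
    rw [this, ← hVP, hP0]
  obtain ⟨m, hm, hpos⟩ := (mem_suppN_iff D y).mp hy
  have hVy : V y = 0 := linZ_term_eq_zero D.N V hNnn hN0 (y, m) hm hpos
  have hf : fat3 h (Equiv.refl _) y ≠ 0 := (fat3_ne_zero_iff hyA (Equiv.refl _)).mpr ⟨hfat 0, hfat 1, hfat 2⟩
  have hx3 : (y 3).x ≠ 0 := (hfat 3).1
  have : V y ≠ 0 := by
    show fat3 h (Equiv.refl _) y * (y 3).x * (y 3).x ≠ 0
    exact mul_ne_zero (mul_ne_zero hf hx3) hx3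
  exact this hVy

end Summit.HodgeConjecture.HodgeConjecture.Cruxes.BlochSeedDiscOne.FatBalance
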